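import Literature.Probability.LatticeModels.KCObservableL2Bound
import HarnessLib

/-!
# The white increment formula for the Kadanoff–Ceva primitive

Topic `Literature/Probability/LatticeModels`. Smirnov 2010, Remark 3.7 (white squares) for the spin
fermion of Chelkak–Hongler–Izyurov 2015 (Prop. 3.6, `H = Re ∫ F²` in their phase convention): for a
Kadanoff–Ceva primitive `(Hw, Hb)` (`IsingDisorderLaplacian.lean`) and the signed observable
`F = kcObs`, across the bond `e_k` at a bulk site `y`,

  `Hw(y + e_k) - Hw(y) = -(1/(√2 c_KC)) · Im(i^k F(e_k)²)`,

from the white increment of the primitive (`IsKCPrimitive.white_increment`), the identification of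
the fluxes of `kcObs` with `c_KC · X²` (`cornerFlux_kcObs`) and Remark 3.7 for spinor sections
(`cornerFlux_sub_cornerFlux_eq_im_of_relAt`; the corner `(y + e_k, k+1)` is always related,
`IsKCCuts.relAt_kcObs`) — no restriction at the seam, the formula being quadratic in `F`. This is
the increment hypothesis of `LatticeToContinuumPrimitive.lean` with `κ = 1/(√2 c_KC)`, `θ₀ = 1`.
Everything is proved; no named fact.

## References

* S. Smirnov, Ann. of Math. 172 (2010), Remark 3.7 [Smirnov2010].
* D. Chelkak, C. Hongler, K. Izyurov, Ann. of Math. 181 (2015), Prop. 3.6 [ChelkakHonglerIzyurovAnnals2015].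
-/

noncomputable section

namespace Literature.Probability.LatticeModels

open Complex SimpleGraph

variable {G₂ : SimpleGraph (Site 2)} [G₂.LocallyFinite]
variable {Λ : Finset (Site 2)} {η : SpinConfig (Site 2)} {B : Finset (Site 2)} {cut : Site 2 → Finset (Sym2 (Site 2))}
  {P : Set (Site 2)} {Hw Hb : Site 2 → ℝ}

/-- **The white increment of the Kadanoff–Ceva primitive across the bond `e_k` at `y`**:
`Hw(y + e_k) - Hw(y) = -(1/(√2 c_KC)) Im(i^k F(e_k)²)`, at a site `y` whose plaquette
`faceAt y k` carries a cut and whose neighbour `y + e_k` is a bulk site (it, its west and south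
neighbours free, its four plaquettes in the cut system). [cite: Smirnov2010, Remark 3.7; ChelkakHonglerIzyurovAnnals2015, Prop. 3.6] -/
theorem IsKCPrimitive.hw_increment_kcObs (h : IsKCPrimitive G₂ Λ criticalBetaTwo (.fixed η) B cut Hw Hb P)
    (hc : IsKCCuts G₂ Λ cut P) (hG : ∀ v ∈ Λ, ∀ k : Fin 4, G₂.Adj v (v + cornerUnit k)) (hle : G₂ ≤ zdGraph 2)
    {y : Site 2} (k : Fin 4) (hk : faceAt y k ∈ P)
    (hy : y + cornerUnit k ∈ Λ) (hyW : y + cornerUnit k + cornerUnit 2 ∈ Λ) (hyS : y + cornerUnit k + cornerUnit 3 ∈ Λ)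
    (hP : ∀ j : Fin 4, faceAt (y + cornerUnit k) j ∈ P) :
    Hw (y + cornerUnit k) - Hw y =
      -(1 / (Real.sqrt 2 * kcFluxConst)) * (I ^ (k : ℕ) * ((1 : ℂ) * kcObs G₂ Λ η B cut (cSrc (y, k))) ^ 2).im := by
  have hrel : RelAt (kcObs G₂ Λ η B cut) (y + cornerUnit k, k + 1) := hc.relAt_kcObs G₂ hG hle hy hyW hyS hP (k + 1)
  have hinc := h.white_increment y k hk
  have hflux := cornerFlux_sub_cornerFlux_eq_im_of_relAt (kcObs G₂ Λ η B cut) y k hrel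
  rw [cornerFlux_kcObs, cornerFlux_kcObs, ← mul_sub, ← hinc] at hflux
  have hκ := kcFluxConst_pos
  have hs : (0 : ℝ) < Real.sqrt 2 := Real.sqrt_pos.2 two_pos
  rw [one_mul]
  field_simp
  field_simp at hflux
  linarith

end Literature.Probability.LatticeModels
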